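import Mathlib
import HarnessLib
import Summits.AtomisticToContinuum.FouriersLaw.Theses.JunctionLocality
import Literature.MathematicalPhysics.KineticTheory.LangevinChainGibbs
import Summits.AtomisticToContinuum.FouriersLaw.Theorems.JunctionLocalitySuperadditiveResistanceKuboFrame
import Summits.AtomisticToContinuum.FouriersLaw.Theorems.JunctionLocalitySuperadditiveResistanceTerminationIdentity
import Summits.AtomisticToContinuum.FouriersLaw.Theorems.JunctionLocalitySuperadditiveResistanceKuboGauss
import Summits.AtomisticToContinuum.FouriersLaw.Theorems.JunctionLocalitySuperadditiveResistanceStubPlainForwardField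
import Summits.AtomisticToContinuum.FouriersLaw.Theorems.JunctionLocalitySuperadditiveResistanceKuboLimit
import Summits.AtomisticToContinuum.FouriersLaw.Theorems.JunctionLocalitySuperadditiveResistanceKuboPlain
import Summits.AtomisticToContinuum.FouriersLaw.Theorems.JunctionLocalitySuperadditiveResistanceStubLinearResponsePlainAux2

/-!
# Far transmission, exact fixed-`N` identities and the reduction of the stub to one `N`-uniform pairing
(stub `stub_farTransmission` of line `thermalise-then-cut-probe-insertion`, skeleton v3.1, crux
`JunctionLocality.SuperadditiveResistance`, stmt-AtomisticToContinuum-11748)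

The stub (FT, upper bound only): `∃ c ∀ N M ≥ 2`, along the pieces' plain Kubo frames
`PlainFrame P T L h_L (D L/(L−1))` and every Kubo frame `KuboFrame P T N M g gb₁ gb₄` of the γ-probed
device, `bypass g ≤ c · G_N · G_M` (`G_L = D L/(L−1)`; `x = bypass g = g 0 3 = (γ²/T²)⟨gb₁, p²_{N+M−1} − T⟩`
is the direct bath-4 → bath-1 transfer conductance past the two γ-thermostatted junction sites). Its
`N`-uniform content ("double escape") is in no engine of the tree; this file proves, with nothing taken as
a named fact, the EXACT FIXED-`N` IDENTITIES that isolate it (the analogue for `g 0 3` of the landed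
`terminationIdentity_left/right` for `selfLeft g`, `…TerminationIdentity.lean`):

* `integral_comp_restrictLeft_mul_kin_far` — the bare left field is ORTHOGONAL to the far bath's energy
  observable: `⟨F∘π_N, p²_{N+M−1} − T⟩_{μ_T^{(N+M)}} = 0` exactly (Gaussian integration by parts in
  `p_{N+M−1}`, on which `F∘π_N` does not depend) — unlike the termination column, far transmission has NO
  static term;
* `farDefect_pairing` — the cross Green identity `Kubo.cross` for the defect `u = gb₁ − g_N∘π_N` (defect
  equation `L_dev u = −V'(r_J)(∂_{p_{N−1}}g_N)∘π_N`, landed `deviceGenerator_defect`) against the BACKWARD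
  field `gb₄∘R` of the far bath: `⟨u, p²_{N+M−1} − T⟩ = ⟨gb₄∘R, V'(r_J)(∂_{p_{N−1}} g_N)∘π_N⟩`;
* `helper_farTransmissionIdentity` (registered): under `KuboFrame`, for every classical forward field `g_N`
  of the bare `N`-piece, `bypass g = (γ²/T²)⟨gb₄∘R, V'(q_N − q_{N−1})(∂_{p_{N−1}} g_N)∘π_N⟩_{μ_T^{(N+M)}}`;
* (sibling file `…StubFarTransmissionMirror.lean`, `helper_farTransmissionIdentityRight`): the mirror by
  Onsager symmetry `g 0 3 = g 3 0` and the block swap, exhibiting the bare `M`-piece's factor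
  `∂_{p_{M−1}} g_M` instead;
* `helper_farTransmissionOfRemainderBound` (registered): the stub FOLLOWS, with the same constant, from the
  `N`-uniform one-sided bound `(γ²/T²)⟨gb₄∘R, V'(r_J)(∂_{p_{N−1}}g_N)∘π_N⟩ ≤ c G_N G_M` over all frames and
  classical `g_N` (the named bet `FarTransmissionRemainderBound`), by the identity and the landed existence
  of `g_N` (`stub_plainForwardField`); conversely the identity shows the bet is implied by the stub, so
  along the crux's frames the two are EQUIVALENT;
* `helper_farTransmissionDirichletBudget` (registered): the FREE `N`-uniform factor — for the bare piece
  under its plain frame, `γT(‖∂_{p_0} g_N‖² + ‖∂_{p_{N−1}} g_N‖²)_{L²(μ_T^{(N)})} = (T²/γ²)(γ − G_N)` exactly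
  (fluctuation–dissipation + the Kubo link `kuboPairing_responseField`), whence
  `‖∂_{p_{N−1}} g_N‖² < T/γ²` as `G_N > 0`.

What remains for the stub is exactly ONE `N`-uniform estimate of the pairing of the far bath's backward
field with the junction forcing of the bare field's momentum gradient at its γ-thermostatted end; a
Cauchy–Schwarz split is NOT expected to give it (`‖gb₄‖_{L²}` grows with the length; the free budget above
is `O(1)`, not `O(G_N)`), the cancellations of the dynamics ("renewal at a bathed site") must enter.
-/

noncomputable section

open MeasureTheory Filter Topology ProbabilityTheory
open scoped ContDiff NNReal ENNReal
open Literature.MathematicalPhysics.KineticTheory.HeatConduction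
open Summit.AtomisticToContinuum.FouriersLaw.Theorems.SuperadditiveResistance.DeviceLiouville
  (liouvilleOp bathOp deviceWeight kin_eq_sq deviceGenerator_eq)
open Summit.AtomisticToContinuum.FouriersLaw.Theorems.SuperadditiveResistance.TerminationLocality
  (memLp_comp_restrictLeft restrictLeft contDiff_restrictLeft deviceGenerator_defect)
open Summit.AtomisticToContinuum.FouriersLaw.Theorems.SuperadditiveResistance.Kubo
  (rev rev_apply contDiff_rev memLp_rev rev_pair cross memLp_partialP memLp_kinetic memLp_momentum gauss_ibp
    fluctuation_dissipation sum_termWeight_mul)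
open Summit.AtomisticToContinuum.FouriersLaw.Theorems.SuperadditiveResistance.KuboPlain
  (generator_eq_liouvilleOp_add_bathOp bathWeight_eq_termWeight bathFin_zero bathFin_one)

namespace Summit.AtomisticToContinuum.FouriersLaw.Cruxes.SuperadditiveResistance.ThermaliseThenCutProbeInsertion

section Green

variable {ω₂ lam β : ℝ} {N M : ℕ}

/-- A left-block observable does not depend on the far momentum `p_{N+M−1}` (`M ≥ 1`):
`∂_{p_{N+M−1}} (F ∘ π_N) = 0`. -/
theorem partialP_far_comp_restrictLeft (hM : 1 ≤ M) (F : PhaseSpace N → ℝ) (x : PhaseSpace (N + M)) :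
    partialP ⟨N + M - 1, by omega⟩
        (fun y : PhaseSpace (N + M) => F (y.1 ∘ Fin.castAdd M, y.2 ∘ Fin.castAdd M)) x = 0 := by
  unfold partialP
  have e : (fun t : ℝ => F ((x.1, Function.update x.2 ⟨N + M - 1, by omega⟩ t).1 ∘ Fin.castAdd M,
      (x.1, Function.update x.2 ⟨N + M - 1, by omega⟩ t).2 ∘ Fin.castAdd M)) =
      fun _ => F (x.1 ∘ Fin.castAdd M, x.2 ∘ Fin.castAdd M) := by
    funext t
    congr 2
    funext j
    simp only [Function.comp_apply]
    rw [Function.update_of_ne]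
    intro h
    have := congrArg Fin.val h
    simp at this
    omega
  rw [e, deriv_const]

/-- **The bare left field is orthogonal to the far bath's energy observable.** For a `C¹`
left-block observable `F ∈ L²(μ_T^{(N)})` (`N, M ≥ 1`):
`⟨F ∘ π_N, p²_{N+M−1} − T⟩_{μ_T^{(N+M)}} = 0` — Gaussian integration by parts in `p_{N+M−1}`
(`gauss_ibp`), on which `F ∘ π_N` does not depend: the far momentum is `N(0,T)` and independent of
the left block under the Gibbs state. -/
theorem integral_comp_restrictLeft_mul_kin_far (hω : 0 < ω₂) (hl : 0 ≤ lam) (hβ : 0 ≤ β) (γ : ℝ)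
    (hN : 1 ≤ N) (hM : 1 ≤ M) {T : ℝ} (hT : 0 < T) {F : PhaseSpace N → ℝ} (hFC : ContDiff ℝ 1 F)
    (hFL2 : MemLp F 2 ((pinnedChain ω₂ lam β γ).gibbsMeasure N T)) :
    ∫ x, F (x.1 ∘ Fin.castAdd M, x.2 ∘ Fin.castAdd M) * (kin (N + M) (N + M - 1) x - T)
        ∂((pinnedChain ω₂ lam β γ).gibbsMeasure (N + M) T) = 0 := by
  set P := pinnedChain ω₂ lam β γ with hP
  have hπC : ContDiff ℝ 1 (fun y : PhaseSpace (N + M) => F (y.1 ∘ Fin.castAdd M, y.2 ∘ Fin.castAdd M)) :=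
    hFC.comp contDiff_restrictLeft
  have hπL2 : MemLp (fun y : PhaseSpace (N + M) => F (y.1 ∘ Fin.castAdd M, y.2 ∘ Fin.castAdd M)) 2
      (P.gibbsMeasure (N + M) T) := memLp_comp_restrictLeft hω hl hβ γ hN hM hT hFL2
  have hd0 : partialP ⟨N + M - 1, by omega⟩
      (fun y : PhaseSpace (N + M) => F (y.1 ∘ Fin.castAdd M, y.2 ∘ Fin.castAdd M)) = fun _ => 0 :=
    funext fun x => partialP_far_comp_restrictLeft hM F x
  have hdL2 : MemLp (partialP ⟨N + M - 1, by omega⟩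
      (fun y : PhaseSpace (N + M) => F (y.1 ∘ Fin.castAdd M, y.2 ∘ Fin.castAdd M))) 2
      (P.gibbsMeasure (N + M) T) := by
    haveI := pinnedChain_isProbabilityMeasure_gibbsMeasure hω hl hβ γ (N + M) hT
    rw [hd0]; exact memLp_const 0
  have h := gauss_ibp hω hl hβ (N + M) hT ⟨N + M - 1, by omega⟩ hπC hπL2 hdL2
  rw [hd0] at h
  simp only [mul_zero, zero_mul, integral_zero] at h
  rw [P.integral_gibbsMeasure]
  have e : (fun x : PhaseSpace (N + M) => F (x.1 ∘ Fin.castAdd M, x.2 ∘ Fin.castAdd M) *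
      (kin (N + M) (N + M - 1) x - T) * P.gibbsDensity (N + M) T x) =
      fun x => (x.2 ⟨N + M - 1, by omega⟩ ^ 2 - T) * F (x.1 ∘ Fin.castAdd M, x.2 ∘ Fin.castAdd M) *
        P.gibbsDensity (N + M) T x := by
    funext x; rw [kin_eq_sq_line (show N + M - 1 < N + M by omega)]; ring
  rw [e, h, mul_zero]

/-- **The far Green pairing across the junction (fixed `N`, `M`; exact).** For the pinned chain
(`ω₂ > 0`, `lam, β ≥ 0`, `γ, T > 0`, `N, M ≥ 1`), classical forward fields `gb₁` of bath 1 (site `0`)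
and `gb₄` of bath 4 (site `N+M−1`) of the `(N, M)`-device (`C² ∩ L²(μ_T^{(N+M)})`,
`L_dev gb = −(p_s² − T)`, all four thermostats at `T`) and a classical forward field `g_N` of the bare
`N`-chain (`C² ∩ L²(μ_T^{(N)})`, `L_N^{T,T} g_N = −(p_0² − T)`), the defect `u = gb₁ − g_N ∘ π_N` has
far pairing
`⟨u, p²_{N+M−1} − T⟩_{μ^{(N+M)}} = ⟨gb₄∘R, V'(q_N − q_{N−1}) · (∂_{p_{N−1}} g_N)∘π_N⟩_{μ^{(N+M)}}`
(`R` the momentum reversal, `V'(r) = r + βr³`): the cross Green identity `Kubo.cross` for the forward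
pair `(u, V'(r_J)(∂_{p_{N−1}}g_N)∘π_N)` (the defect equation `deviceGenerator_defect`) against the
BACKWARD pair `(gb₄∘R, p²_{N+M−1} − T)` of the far bath. -/
theorem farDefect_pairing (hω : 0 < ω₂) (hl : 0 ≤ lam) (hβ : 0 ≤ β) {γ : ℝ} (hγ : 0 < γ)
    (hN : 1 ≤ N) (hM : 1 ≤ M) {T : ℝ} (hT : 0 < T)
    {gb₁ : PhaseSpace (N + M) → ℝ} (h1C : ContDiff ℝ 2 gb₁)
    (h1L2 : MemLp gb₁ 2 ((pinnedChain ω₂ lam β γ).gibbsMeasure (N + M) T))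
    (h1pde : ∀ x, deviceGenerator (pinnedChain ω₂ lam β γ) N M (fun _ => T) gb₁ x = -(kin (N + M) 0 x - T))
    {gb₄ : PhaseSpace (N + M) → ℝ} (h4C : ContDiff ℝ 2 gb₄)
    (h4L2 : MemLp gb₄ 2 ((pinnedChain ω₂ lam β γ).gibbsMeasure (N + M) T))
    (h4pde : ∀ x, deviceGenerator (pinnedChain ω₂ lam β γ) N M (fun _ => T) gb₄ x =
      -(kin (N + M) (N + M - 1) x - T))
    {gN : PhaseSpace N → ℝ} (hgC : ContDiff ℝ 2 gN) (hgL2 : MemLp gN 2 ((pinnedChain ω₂ lam β γ).gibbsMeasure N T))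
    (hgpde : ∀ y, (pinnedChain ω₂ lam β γ).generator N T T gN y = -(kin N 0 y - T)) :
    ∫ x, (gb₁ x - gN (x.1 ∘ Fin.castAdd M, x.2 ∘ Fin.castAdd M)) * (kin (N + M) (N + M - 1) x - T)
        ∂((pinnedChain ω₂ lam β γ).gibbsMeasure (N + M) T) =
      ∫ x, gb₄ (x.1, -x.2) *
        (((x.1 ⟨N, by omega⟩ - x.1 ⟨N - 1, by omega⟩) + β * (x.1 ⟨N, by omega⟩ - x.1 ⟨N - 1, by omega⟩) ^ 3) *
          partialP ⟨N - 1, by omega⟩ gN (x.1 ∘ Fin.castAdd M, x.2 ∘ Fin.castAdd M))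
        ∂((pinnedChain ω₂ lam β γ).gibbsMeasure (N + M) T) := by
  -- adapted from `defect_pairing` (…TerminationIdentity): the backward pair is now the far bath's
  set μ := (pinnedChain ω₂ lam β γ).gibbsMeasure (N + M) T with hμ
  set u : PhaseSpace (N + M) → ℝ := fun y => gb₁ y - gN (restrictLeft N M y) with hu
  set ku : PhaseSpace (N + M) → ℝ := fun x =>
    (((x.1 ⟨N, by omega⟩ - x.1 ⟨N - 1, by omega⟩) + β * (x.1 ⟨N, by omega⟩ - x.1 ⟨N - 1, by omega⟩) ^ 3) *
      partialP ⟨N - 1, by omega⟩ gN (restrictLeft N M x)) with hku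
  have hgNπ : ContDiff ℝ 2 (gN ∘ restrictLeft N M) := hgC.comp contDiff_restrictLeft
  have huC : ContDiff ℝ 2 u := h1C.sub hgNπ
  have huL2 : MemLp u 2 μ := h1L2.sub (memLp_comp_restrictLeft hω hl hβ γ hN hM hT hgL2)
  -- the defect equation in pair form
  have hdef := deviceGenerator_defect ω₂ lam β γ T hN hM h1C hgC (fun x => h1pde x) hgpde
  have hpair_u : ∀ x, 1 * liouvilleOp (pinnedChain ω₂ lam β γ) (N + M) u x +
      γ * bathOp (N + M) (deviceWeight N M) T u x = -ku x := by
    intro x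
    have h1 := hdef x
    rw [deviceGenerator_eq] at h1
    have : (pinnedChain ω₂ lam β γ).γ = γ := rfl
    rw [this] at h1
    rw [one_mul]
    exact h1
  -- the backward pair `(gb₄∘R, p²_{N+M−1} − T)`
  have hpair_b : ∀ x, 1 * liouvilleOp (pinnedChain ω₂ lam β γ) (N + M) gb₄ x +
      γ * bathOp (N + M) (deviceWeight N M) T gb₄ x = -(kin (N + M) (N + M - 1) x - T) := by
    intro x
    have h1 := h4pde x
    have e : deviceGenerator (pinnedChain ω₂ lam β γ) N M (fun _ => T) gb₄ x =
        Summit.AtomisticToContinuum.FouriersLaw.Theorems.SuperadditiveResistance.DeviceLiouville.deviceGenerator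
          (pinnedChain ω₂ lam β γ) N M (fun _ => T) gb₄ x := rfl
    rw [e, deviceGenerator_eq] at h1
    have : (pinnedChain ω₂ lam β γ).γ = γ := rfl
    rw [this] at h1
    rw [one_mul]
    exact h1
  have hpair_rev : ∀ x, -1 * liouvilleOp (pinnedChain ω₂ lam β γ) (N + M) (rev gb₄) x +
      γ * bathOp (N + M) (deviceWeight N M) T (rev gb₄) x = -(kin (N + M) (N + M - 1) x - T) := by
    intro x
    have h := rev_pair (pinnedChain ω₂ lam β γ) (deviceWeight N M) T 1 γ hpair_b x
    rw [h, rev_apply, kin_neg_momentum]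
  -- regularity
  have hrevC : ContDiff ℝ 2 (rev gb₄) := contDiff_rev h4C
  have hrevL2 : MemLp (rev gb₄) 2 μ := memLp_rev hω hl hβ (N + M) hT h4C.continuous h4L2
  have hkf : MemLp (fun x : PhaseSpace (N + M) => kin (N + M) (N + M - 1) x - T) 2 μ := by
    have e : (fun x : PhaseSpace (N + M) => kin (N + M) (N + M - 1) x - T) =
        fun x => x.2 ⟨N + M - 1, by omega⟩ ^ 2 - T := by
      funext x; rw [kin_eq_sq_line (show N + M - 1 < N + M by omega)]
    rw [e]; exact memLp_kinetic (γ := γ) hω hl hβ (N + M) hT ⟨N + M - 1, by omega⟩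
  have hdgN : MemLp (partialP ⟨N - 1, by omega⟩ gN) 2 ((pinnedChain ω₂ lam β γ).gibbsMeasure N T) :=
    memLp_partialP_plainField hω hl hβ hγ hN hT hgC hgL2 hgpde
  have hkuL2 : MemLp ku 2 μ :=
    memLp_junctionForce_mul_comp_restrictLeft hω hl hβ γ hN hM hT
      (continuous_partialP (hgC.of_le (by norm_cast) : ContDiff ℝ 1 gN) one_ne_zero _) hdgN
  -- the cross Green identity
  have hcross := cross hω hl hβ (N + M) hT (deviceWeight N M) (deviceWeight_nonneg N M) 1 hγ
    huC hrevC huL2 hrevL2 hkuL2 hkf hpair_u hpair_rev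
  -- back to the Gibbs measure
  rw [(pinnedChain ω₂ lam β γ).integral_gibbsMeasure, (pinnedChain ω₂ lam β γ).integral_gibbsMeasure]
  congr 1
  have e1 : (fun x => (gb₁ x - gN (x.1 ∘ Fin.castAdd M, x.2 ∘ Fin.castAdd M)) * (kin (N + M) (N + M - 1) x - T) *
      (pinnedChain ω₂ lam β γ).gibbsDensity (N + M) T x) =
      fun x => u x * (kin (N + M) (N + M - 1) x - T) * (pinnedChain ω₂ lam β γ).gibbsDensity (N + M) T x := rfl
  have e2 : (fun x => gb₄ (x.1, -x.2) *
      (((x.1 ⟨N, by omega⟩ - x.1 ⟨N - 1, by omega⟩) + β * (x.1 ⟨N, by omega⟩ - x.1 ⟨N - 1, by omega⟩) ^ 3) *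
        partialP ⟨N - 1, by omega⟩ gN (x.1 ∘ Fin.castAdd M, x.2 ∘ Fin.castAdd M)) *
      (pinnedChain ω₂ lam β γ).gibbsDensity (N + M) T x) =
      fun x => rev gb₄ x * ku x * (pinnedChain ω₂ lam β γ).gibbsDensity (N + M) T x := rfl
  rw [e1, e2, hcross]

end Green

/-! ## The far-transmission identity and the reduction of the stub to the remainder bound -/

section Identity

/-- **FAR-TRANSMISSION IDENTITY (fixed `N`, `M`; exact; v3 vocabulary).** Under the equilibrium Kubo
frame `KuboFrame P T N M g gb₁ gb₄` of the γ-probed device (`P = pinnedChain ω₂ lam β γ`, `ω₂ > 0`,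
`lam, β ≥ 0`, `γ, T > 0`, `N, M ≥ 1`), for EVERY classical forward field `g_N ∈ C² ∩ L²(μ_T^{(N)})` of
the bare `N`-piece's left bath (`L_N^{T,T} g_N = −(p_0² − T)`; one exists by the landed
`stub_plainForwardField`), the bypass (direct bath-4 → bath-1 transfer conductance) is the single
cross Green pairing

  `x = bypass g = g 0 3 = (γ²/T²) · ⟨gb₄∘R, V'(q_N − q_{N−1}) · (∂_{p_{N−1}} g_N)∘π_N⟩_{μ_T^{(N+M)}}`

(`R` the momentum reversal, `V'(r) = r + βr³`, `π_N` the left-block map). Proof: the Kubo row of the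
frame gives `x = (γ²/T²)⟨gb₁, p²_{N+M−1} − T⟩`; split `gb₁ = u + g_N∘π_N`; the bare part pairs to ZERO
EXACTLY (`integral_comp_restrictLeft_mul_kin_far`: `p_{N+M−1}` is `N(0,T)` and independent of the left
block under `μ_T`), and the defect part is the far Green pairing `farDefect_pairing`. So the stub FT
(`x ≤ c G_N G_M`, `N`-uniform) is EXACTLY an `N`-uniform bound on this one pairing of the far bath's
backward field with the junction forcing of the bare field's momentum gradient at its γ-thermostatted
end (`helper_farTransmissionOfRemainderBound`). No plain frame is needed for the identity itself. -/
theorem helper_farTransmissionIdentity : ∀ (ω₂ lam β γ T : ℝ), 0 < ω₂ → 0 ≤ lam → 0 ≤ β → 0 < γ → 0 < T → ∀ (N M : ℕ) (hN : 1 ≤ N) (hM : 1 ≤ M) (g : Fin 4 → Fin 4 → ℝ) (gb₁ gb₄ : PhaseSpace (N + M) → ℝ) (gN : PhaseSpace N → ℝ), KuboFrame (pinnedChain ω₂ lam β γ) T N M g gb₁ gb₄ → ContDiff ℝ 2 gN → MemLp gN 2 ((pinnedChain ω₂ lam β γ).gibbsMeasure N T) → (∀ y, (pinnedChain ω₂ lam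 β γ).generator N T T gN y = -(kin N 0 y - T)) → bypass g = γ ^ 2 / T ^ 2 * ∫ x, gb₄ (x.1, -x.2) * (((x.1 ⟨N, by omega⟩ - x.1 ⟨N - 1, by omega⟩) + β * (x.1 ⟨N, by omega⟩ - x.1 ⟨N - 1, by omega⟩) ^ 3) * partialP ⟨N - 1, by omega⟩ gN (x.1 ∘ Fin.castAdd M, x.2 ∘ Fin.castAdd M)) ∂((pinnedChain ω₂ lam β γ).gibbsMeasure (N + M) T) := by
  intro ω₂ lam β γ T hω hl hβ hγ hT N M hN hM g gb₁ gb₄ gN hKF hgC hgL2 hgpde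
  set P := pinnedChain ω₂ lam β γ with hP
  obtain ⟨-, -, hff1, hff4, hK1, -, -, -⟩ := hKF
  obtain ⟨h1C, h1L2, -, -, h1pde⟩ := hff1
  obtain ⟨h4C, h4L2, -, -, h4pde⟩ := hff4
  -- the Kubo row of bath 1, column of bath 4 (terminal `3`, site `N + M − 1`)
  have hx : bypass g = P.γ ^ 2 / T ^ 2 *
      ∫ x, gb₁ x * (kin (N + M) (N + M - 1) x - T) ∂(P.gibbsMeasure (N + M) T) := by
    have h := hK1 3 (by decide)
    have e : termSite N M 3 = N + M - 1 := rfl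
    rw [e] at h
    exact h
  have hD := farDefect_pairing hω hl hβ hγ hN hM hT h1C h1L2 h1pde h4C h4L2 h4pde hgC hgL2 hgpde
  have h0 := integral_comp_restrictLeft_mul_kin_far (M := M) hω hl hβ γ hN hM hT
    (hgC.of_le (by norm_cast) : ContDiff ℝ 1 gN) hgL2
  -- split `⟨gb₁, p²_{N+M−1} − T⟩ = ⟨u, ·⟩ + ⟨g_N∘π_N, ·⟩`
  have hk : MemLp (fun x : PhaseSpace (N + M) => kin (N + M) (N + M - 1) x - T) 2 (P.gibbsMeasure (N + M) T) := by
    have e : (fun x : PhaseSpace (N + M) => kin (N + M) (N + M - 1) x - T) =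
        fun x => x.2 ⟨N + M - 1, by omega⟩ ^ 2 - T := by
      funext x; rw [kin_eq_sq_line (show N + M - 1 < N + M by omega)]
    rw [e]; exact memLp_kinetic (γ := γ) hω hl hβ (N + M) hT ⟨N + M - 1, by omega⟩
  have hgNπ : MemLp (fun x : PhaseSpace (N + M) => gN (x.1 ∘ Fin.castAdd M, x.2 ∘ Fin.castAdd M)) 2
      (P.gibbsMeasure (N + M) T) := memLp_comp_restrictLeft hω hl hβ γ hN hM hT hgL2
  have hI1 : Integrable (fun x => (gb₁ x - gN (x.1 ∘ Fin.castAdd M, x.2 ∘ Fin.castAdd M)) *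
      (kin (N + M) (N + M - 1) x - T)) (P.gibbsMeasure (N + M) T) := (h1L2.sub hgNπ).integrable_mul hk
  have hI2 : Integrable (fun x => gN (x.1 ∘ Fin.castAdd M, x.2 ∘ Fin.castAdd M) *
      (kin (N + M) (N + M - 1) x - T)) (P.gibbsMeasure (N + M) T) := hgNπ.integrable_mul hk
  have hsplit : ∫ x, gb₁ x * (kin (N + M) (N + M - 1) x - T) ∂(P.gibbsMeasure (N + M) T) =
      (∫ x, (gb₁ x - gN (x.1 ∘ Fin.castAdd M, x.2 ∘ Fin.castAdd M)) * (kin (N + M) (N + M - 1) x - T)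
        ∂(P.gibbsMeasure (N + M) T)) +
        ∫ x, gN (x.1 ∘ Fin.castAdd M, x.2 ∘ Fin.castAdd M) * (kin (N + M) (N + M - 1) x - T)
          ∂(P.gibbsMeasure (N + M) T) := by
    rw [← integral_add hI1 hI2]
    exact integral_congr_ae (ae_of_all _ fun x => by ring)
  rw [hx, hsplit, hD, h0, add_zero]
  rfl

/-- **Reduction of the stub to the far remainder bound.** If the far-transmission pairing is bounded
one-sidedly and `N`-UNIFORMLY along the crux's frames — `∀ N M ≥ 2`, for all plain Kubo frames of the
two bare pieces (`G_N = D N/(N−1)`, `G_M = D M/(M−1)`: the Kubo handles on the pieces' conductances),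
every Kubo frame of the device and every classical forward field `g_N` of the bare `N`-piece,
`(γ²/T²)⟨gb₄∘R, V'(r_J)(∂_{p_{N−1}} g_N)∘π_N⟩_{μ^{(N+M)}} ≤ c · G_N · G_M` (the named bet
`FarTransmissionRemainderBound` with constant `c`) — then the conclusion of `stub_farTransmission` holds
with the same constant along the pieces' plain frames: `bypass g ≤ c G_N G_M` for every Kubo frame,
`N, M ≥ 2`, by `helper_farTransmissionIdentity` and the landed existence of `g_N`
(`stub_plainForwardField`). Conversely the identity shows the bet is implied by the stub (take the
`g_N` of `stub_plainForwardField`, or any: the pairing does not depend on the choice), so along the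
crux's frames the stub IS this `N`-uniform estimate. -/
theorem helper_farTransmissionOfRemainderBound : ∀ (ω₂ lam β γ T : ℝ), 0 < ω₂ → 0 < lam → 0 < β → 0 < γ → 0 < T → ∀ (D : ℕ → ℝ) (c : ℝ), (∀ (N M : ℕ) (hN : 2 ≤ N) (hM : 2 ≤ M) (h₁ : PhaseSpace N → ℝ) (h₂ : PhaseSpace M → ℝ) (g : Fin 4 → Fin 4 → ℝ) (gb₁ gb₄ : PhaseSpace (N + M) → ℝ) (gN : PhaseSpace N → ℝ), PlainFrame (pinnedChain ω₂ lam β γ) T N h₁ (D N / ((N : ℝ) - 1)) → PlainFrame (pinnedChain ω₂ lam β γ) T M h₂ (D M / ((M : ℝ) - 1)) → KuboFrame (pinnedChain ω₂ lam β γ) T N M g gb₁ gb₄ → ContDiff ℝ 2 gN → MemLp gN 2 ((pinnedChain ω₂ lam β γ).gibbsMeasure N T) → (∀ y, (pinnedChain ω₂ lam β γ).generator N T T gN y = -(kin N 0 y - T)) → γ ^ 2 / T ^ 2 * ∫ x, gb₄ (x.1, -x.2) * (((x.1 ⟨N, by omega⟩ - x.1 ⟨N - 1, by omega⟩) + β *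 (x.1 ⟨N, by omega⟩ - x.1 ⟨N - 1, by omega⟩) ^ 3) * partialP ⟨N - 1, by omega⟩ gN (x.1 ∘ Fin.castAdd M, x.2 ∘ Fin.castAdd M)) ∂((pinnedChain ω₂ lam β γ).gibbsMeasure (N + M) T) ≤ c * (D N / ((N : ℝ) - 1)) * (D M / ((M : ℝ) - 1))) → (∀ L : ℕ, 2 ≤ L → ∃ h : PhaseSpace L → ℝ, PlainFrame (pinnedChain ω₂ lam β γ) T L h (D L / ((L : ℝ) - 1))) → ∀ (N M : ℕ), 2 ≤ N → 2 ≤ M → ∀ (g : Fin 4 → Fin 4 → ℝ) (gb₁ gb₄ : PhaseSpace (N + M) → ℝ), KuboFrame (pinnedChain ω₂ lam β γ) T N M g gb₁ gb₄ → bypass g ≤ c * (D N / ((N : ℝ) - 1)) * (D M / ((M : ℝ) - 1)) := by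
  intro ω₂ lam β γ T hω hlam hβ hγ hT D c hRB hPlain N M hN hM g gb₁ gb₄ hKF
  obtain ⟨gN, hgC, hgL2, -, hgpde⟩ :=
    FloatingProbeBypassLaplacian.stub_plainForwardField ω₂ lam β γ T hω hlam hβ hγ hT N hN
  obtain ⟨h₁, hPF₁⟩ := hPlain N hN
  obtain ⟨h₂, hPF₂⟩ := hPlain M hM
  have hid := helper_farTransmissionIdentity ω₂ lam β γ T hω hlam.le hβ.le hγ hT N M (by omega) (by omega)
    g gb₁ gb₄ gN hKF hgC hgL2 (fun y => hgpde y)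
  rw [hid]
  exact hRB N M hN hM h₁ h₂ g gb₁ gb₄ gN hPF₁ hPF₂ hKF hgC hgL2 (fun y => hgpde y)

end Identity

/-! ## The free `N`-uniform factor: the Dirichlet budget of the bare field -/

section Budget

/-- **Dirichlet budget of the bare forward field (exact, `N`-uniform).** For the bare `N`-piece
(`N ≥ 2`) under its plain Kubo frame `PlainFrame P T N h G` (in the line `G = G_N = D N/(N−1)`) and
every classical forward field `g_N` of its left bath, the momentum gradients of `g_N` at the two
γ-thermostatted end sites carry exactly the conductance DEFICIT:

  `γT · (‖∂_{p_0} g_N‖²_{L²(μ_T^{(N)})} + ‖∂_{p_{N−1}} g_N‖²_{L²(μ_T^{(N)})}) = (T²/γ²)(γ − G)`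

— the finite-volume fluctuation–dissipation identity `⟨g_N, p_0² − T⟩ = γT Σ_b ‖∂_{p_b} g_N‖²`
(`Kubo.fluctuation_dissipation`) and the Kubo link of the plain frame
`G = γ − (γ²/T²)⟨g_N, p_0² − T⟩` (`kuboPairing_responseField`). Since `G_N > 0` along the crux
(`CruxFrame`: `D N > 0`), the far-end factor of the far-transmission pairing obeys the FREE `N`-uniform
bound `‖∂_{p_{N−1}} g_N‖²_{L²(μ_T^{(N)})} < T/γ²` (and `G_N ≤ γ`). -/
theorem helper_farTransmissionDirichletBudget : ∀ (ω₂ lam β γ T : ℝ), 0 < ω₂ → 0 ≤ lam → 0 < β → 0 < γ → 0 < T → ∀ (N : ℕ) (hN : 2 ≤ N) (h : PhaseSpace N → ℝ) (G : ℝ) (gN : PhaseSpace N → ℝ), PlainFrame (pinnedChain ω₂ lam β γ) T N h G → ContDiff ℝ 2 gN → MemLp gN 2 ((pinnedChain ω₂ lam β γ).gibbsMeasure N T) → (∀ y, (pinnedChain ω₂ lam β γ).generator N T T gN y = -(kin N 0 y - T)) → γ * T * ((∫ y, partialP ⟨0, by omega⟩ gN y ^ 2 ∂((pinnedChain ω₂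 lam β γ).gibbsMeasure N T)) + ∫ y, partialP ⟨N - 1, by omega⟩ gN y ^ 2 ∂((pinnedChain ω₂ lam β γ).gibbsMeasure N T)) = T ^ 2 / γ ^ 2 * (γ - G) := by
  intro ω₂ lam β γ T hω hl hβ hγ hT N hN h G gN hPF hgC hgL2 hgpde
  set P := pinnedChain ω₂ lam β γ with hP
  -- the Kubo link of the v3 plain frame: `G = γ − (γ²/T²)⟨g_N, p_0² − T⟩`
  obtain ⟨hh, -, hG0⟩ := hPF
  have hG : G = γ - γ ^ 2 / T ^ 2 * ∫ y, gN y * (kin N 0 y - T) ∂(P.gibbsMeasure N T) := by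
    rw [hG0, kuboPairing_responseField hω hl hβ hγ (show 0 < N by omega) hT hh hgC hgL2 hgpde]
    have : P.γ = γ := rfl
    rw [this]
    ring
  -- the forward pair and the fluctuation–dissipation identity
  have hpair : ∀ y, 1 * liouvilleOp P N gN y + γ * bathOp N (OscillatorChain.bathWeight N) T gN y =
      -(kin N 0 y - T) := by
    intro y
    rw [← hgpde y, generator_eq_liouvilleOp_add_bathOp]
    have : P.γ = γ := rfl
    rw [this, one_mul]
  have hk : MemLp (fun y : PhaseSpace N => kin N 0 y - T) 2 (P.gibbsMeasure N T) := by
    have e : (fun y : PhaseSpace N => kin N 0 y - T) = fun y => y.2 ⟨0, by omega⟩ ^ 2 - T := by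
      funext y; rw [kin_eq_sq_line (show 0 < N by omega)]
    rw [e]; exact memLp_kinetic (γ := γ) hω hl hβ.le N hT ⟨0, by omega⟩
  have hB : ∀ i : Fin N, 0 ≤ OscillatorChain.bathWeight N i := fun i => by
    unfold OscillatorChain.bathWeight; split_ifs <;> norm_num
  have hFD := fluctuation_dissipation hω hl hβ.le N hT _ hB 1 hγ hgC hgL2 hk hpair
  have hsum : ∑ i, OscillatorChain.bathWeight N i * ∫ y, partialP i gN y ^ 2 * P.gibbsDensity N T y =
      (∫ y, partialP ⟨0, by omega⟩ gN y ^ 2 * P.gibbsDensity N T y) +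
        ∫ y, partialP ⟨N - 1, by omega⟩ gN y ^ 2 * P.gibbsDensity N T y := by
    rw [bathWeight_eq_termWeight hN, sum_termWeight_mul, Fin.sum_univ_two, bathFin_zero, bathFin_one]
  rw [hsum] at hFD
  rw [hG, P.integral_gibbsMeasure, P.integral_gibbsMeasure, P.integral_gibbsMeasure, hFD]
  have hγ0 : γ ≠ 0 := hγ.ne'
  have hT0 : T ≠ 0 := hT.ne'
  field_simp
  ring

end Budget

end Summit.AtomisticToContinuum.FouriersLaw.Cruxes.SuperadditiveResistance.ThermaliseThenCutProbeInsertion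

end
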